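import Literature.MathematicalPhysics.QuantumFieldTheory.ConformalBootstrap3D.ZSeriesBlockCoefficients
import Mathlib.Tactic
import HarnessLib

/-!
# The Casimir pair in the Hogervorst–Rychkov frame: quadratic recursion operator and the closure stencil

Hogervorst–Rychkov, Phys. Rev. D 87 (2013) 106004 [arXiv:1303.1111], §3 eqs. (3.6)–(3.9): in the basis
`𝒫_{E,j}(z,z̄) = |z|^E P_j(cos arg z)` the quadratic Casimir `𝒟₂` (Dolan–Osborn 2011 eq. (2.10)–(2.12), `d = 3`)
acts by a three-point stencil, `𝒟₂ 𝒫_{E,j} = C_{E,j} 𝒫_{E,j} - ½γ⁺_{E,j} 𝒫_{E+1,j+1} - ½γ⁻_{E,j} 𝒫_{E+1,j-1}`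
(`C = casimirEigenvalue3D`, `γ^± = hrGammaPlus/Minus`), and the block's coefficient array `A_{n,j}(Δ,ℓ) = hrCoeff Δ ℓ n j`
is the solution of `𝒟₂ A = C_{Δ,ℓ} A` with apex `A_{0,j} = δ_{jℓ}` (the recursion (3.9)). Dolan–Osborn,
arXiv:1108.6194, §4.2: the QUARTIC Casimir `𝒟₄ = (z z̄/(z-z̄)) (D_z - D_z̄) ((z-z̄)/(z z̄)) (D_z - D_z̄)` (their
`Δ₄^{(ε)}(a,b)` at `2ε = 1`, `a = b = 0`) commutes with `𝒟₂` and has the blocks as eigenfunctions with eigenvalue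
`c₄ = ℓ(ℓ+1)(Δ-1)(Δ-2)` (their `c_{4,λ₁λ₂} = (λ₁-λ₂)(λ₁-λ₂+2ε)(λ₁+λ₂-1)(λ₁+λ₂-1-2ε)`).

This file works purely with ARRAYS `x : ℤ → ℤ → ℝ` ("coefficient of `𝒫_{E₀+M, j}` at `(M, j)`") and transcribes:

* `opD2 E₀` — the three-point stencil of `𝒟₂` (`d2diag`, `d2up`, `d2dn`);
* `opL p E₀` — the four-point stencil of the CLOSURE OPERATOR `𝕃_p := 𝒟₄ - (𝒟₂ - c₀)(𝒟₂ - c₁)`,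
  `c₀ = 2p²-3p = C_{2p,0}`, `c₁ = (2p-1)(p-2)`, whose coefficients (`clDiag`, `clUp`, `clDn`, `clTwo`; the
  `𝒫_{E+2,j±2}` components of `𝒟₄` and `𝒟₂²` cancel) were obtained by expanding Dolan–Osborn's `𝒟₄` in the
  `𝒫`-basis with computer algebra (pub-ising3d-lit-g9 `code/mft3d_d4.py`, `mft3d_stencil.py`,
  `mft3d_closure_gen.py`); what is PROVED here is all that is used downstream: `opD2_opL_comm` — the two stencils
  commute (seven rational identities between the coefficients, `comm_coef₁`–`comm_coef₇`) — and its consequences;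
* `hrCoeffZ Δ ℓ` — the block array extended by zero to `ℤ × ℤ`; `opD2_hrCoeffZ` — it is an eigen-array of `opD2 Δ`
  with eigenvalue `C_{Δ,ℓ}` for `Δ` above the unitarity bound (the recursion (3.9); pivots positive on the descendant
  range by `casimirPivot3D_pos`, both sides zero off it); `eq_smul_hrCoeffZ_of_eigen` — UNIQUENESS of range-supported
  eigen-arrays with given apex; `opL_hrCoeffZ` — hence the block array is an eigen-array of the closure stencil,
  `𝕃_p A(Δ,ℓ) = ℓ_p(Δ,ℓ) A(Δ,ℓ)` with `ℓ_p(E,j) = clDiag p E j = -¼(2p-E+j)(2p-E-j-1)(2p+E-j-4)(2p+E+j-3)`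
  (`= c₄(E,j) - (C_{E,j}-c₀)(C_{E,j}-c₁)`).

The diagonal symbol `ℓ_p(2p+2n+ℓ, ℓ) = -n(2ℓ+2n+1)(n+2p-2)(2ℓ+2n+4p-3)` vanishes exactly on the leading twist
`n = 0` for `p > 1/2`; this is what drives the mean-field decomposition (`MeanFieldDecomposition`).
Cross-checks (exact rationals / computer algebra, not part of the proofs): `[𝔻₂, 𝔻₄] = 0` and the stencil of `𝒟₄`
for `j ≤ 8` symbolically in `E` (`mft3d_stencil.py`), pub-ising3d-lit-g9.
[cite: HogervorstRychkov2013, §3 eqs. (3.6)–(3.9)] [cite: DolanOsborn2011, §4.2]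
-/

namespace Literature.MathematicalPhysics.QuantumFieldTheory.ConformalBootstrap3D

open Finset

/-! ### Coefficient functions of the two stencils (real arguments `E`, `j`) -/

/-- Diagonal coefficient of `𝒟₂`: `C_{E,j} = (E(E-3) + j(j+1))/2`. [cite: HogervorstRychkov2013, §3 eq. (3.7)] -/
noncomputable def d2diag (E j : ℝ) : ℝ := (E * (E - 3) + j * (j + 1)) / 2

/-- Coefficient of `𝒫_{E+1,j+1}` in `𝒟₂ 𝒫_{E,j}`: `-½γ⁺_{E,j} = -(j+1)(E+j)²/(2(2j+1))`.
[cite: HogervorstRychkov2013, §3 eq. (3.8)] -/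
noncomputable def d2up (E j : ℝ) : ℝ := -((j + 1) * (E + j) ^ 2) / (2 * (2 * j + 1))

/-- Coefficient of `𝒫_{E+1,j-1}` in `𝒟₂ 𝒫_{E,j}`: `-½γ⁻_{E,j} = -j(E-j-1)²/(2(2j+1))`.
[cite: HogervorstRychkov2013, §3 eq. (3.8)] -/
noncomputable def d2dn (E j : ℝ) : ℝ := -(j * (E - j - 1) ^ 2) / (2 * (2 * j + 1))

/-- Diagonal symbol of the closure operator `𝕃_p = 𝒟₄ - (𝒟₂-c₀)(𝒟₂-c₁)` on `𝒫_{E,j}`: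
`ℓ_p(E,j) = -¼(2p-E+j)(2p-E-j-1)(2p+E-j-4)(2p+E+j-3)` (`= c₄(E,j) - (C_{E,j}-c₀)(C_{E,j}-c₁)`,
`c₄ = j(j+1)(E-1)(E-2)` the quartic-Casimir eigenvalue of Dolan–Osborn 2011 §4.2). [cite: DolanOsborn2011, §4.2] -/
noncomputable def clDiag (p E j : ℝ) : ℝ :=
  -((2 * p - E + j) * (2 * p - E - j - 1) * (2 * p + E - j - 4) * (2 * p + E + j - 3)) / 4

/-- Coefficient of `𝒫_{E+1,j+1}` in `𝕃_p 𝒫_{E,j}`. [cite: DolanOsborn2011, §4.2] -/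
noncomputable def clUp (p E j : ℝ) : ℝ :=
  -((j + 1) * (E + j) ^ 2 * (2 * p - E + j) * (2 * p + E - j - 4)) / (2 * (2 * j + 1))

/-- Coefficient of `𝒫_{E+1,j-1}` in `𝕃_p 𝒫_{E,j}`. [cite: DolanOsborn2011, §4.2] -/
noncomputable def clDn (p E j : ℝ) : ℝ :=
  -(j * (E - j - 1) ^ 2 * (2 * p - E - j - 1) * (2 * p + E + j - 3)) / (2 * (2 * j + 1))

/-- Coefficient of `𝒫_{E+2,j}` in `𝕃_p 𝒫_{E,j}` (independent of `p`): `-(E+j)²(E-j-1)²/4`.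
[cite: DolanOsborn2011, §4.2] -/
noncomputable def clTwo (E j : ℝ) : ℝ := -((E + j) ^ 2 * (E - j - 1) ^ 2) / 4

/-- `d2diag E j = casimirEigenvalue3D E j`. [cite: HogervorstRychkov2013, §3 eq. (3.7)] -/
theorem d2diag_eq (E : ℝ) (j : ℕ) : d2diag E j = casimirEigenvalue3D E j := by
  unfold d2diag casimirEigenvalue3D; ring

/-- `d2up E j = -hrGammaPlus E j / 2`. [cite: HogervorstRychkov2013, §3 eq. (3.8)] -/
theorem d2up_eq (E : ℝ) (j : ℕ) : d2up E j = -(hrGammaPlus E j) / 2 := by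
  unfold d2up hrGammaPlus
  have h : (2 * (j : ℝ) + 1) ≠ 0 := by positivity
  field_simp

/-- `d2dn E j = -hrGammaMinus E j / 2`. [cite: HogervorstRychkov2013, §3 eq. (3.8)] -/
theorem d2dn_eq (E : ℝ) (j : ℕ) : d2dn E j = -(hrGammaMinus E j) / 2 := by
  unfold d2dn hrGammaMinus
  have h : (2 * (j : ℝ) + 1) ≠ 0 := by positivity
  field_simp

/-- `d2dn E 0 = 0` ("the coefficients which do not exist come out automatically zero"). [cite: HogervorstRychkov2013, §3 after eq. (3.10)] -/
@[simp] theorem d2dn_zero (E : ℝ) : d2dn E 0 = 0 := by simp [d2dn]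

/-- `clDn p E 0 = 0`. [folklore] -/
@[simp] theorem clDn_zero (p E : ℝ) : clDn p E 0 = 0 := by simp [clDn]

/-- The diagonal symbol on the double-twist family: `ℓ_p(2p+2n+ℓ, ℓ) = -n(2ℓ+2n+1)(n+2p-2)(2ℓ+2n+4p-3)`. [folklore] -/
theorem clDiag_twist (p n ℓ : ℝ) :
    clDiag p (2 * p + 2 * n + ℓ) ℓ = -(n * (2 * ℓ + 2 * n + 1) * (n + 2 * p - 2) * (2 * ℓ + 2 * n + 4 * p - 3)) := by
  unfold clDiag; ring

/-- The diagonal symbol vanishes on the leading twist `E = 2p + ℓ`. [folklore] -/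
theorem clDiag_leading (p ℓ : ℝ) : clDiag p (2 * p + ℓ) ℓ = 0 := by
  unfold clDiag; ring

/-- The pivot of the closure stencil: `clDiag p (2p+M) j ≠ 0` for `p > 1/2`, `0 ≤ j`, `j + 2 ≤ M`, `M - j` even. [folklore] -/
theorem clDiag_ne_zero {p : ℝ} (hp : 1 / 2 < p) {M j : ℤ} (hj : 0 ≤ j) (hjM : j + 2 ≤ M)
    (hpar : Even (M - j)) : clDiag p (2 * p + M) j ≠ 0 := by
  obtain ⟨k, hk⟩ := hpar
  have hk1 : 1 ≤ k := by omega
  have hM : (M : ℝ) = 2 * k + j := by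
    have : M = 2 * k + j := by omega
    exact_mod_cast this
  have hk1' : (1 : ℝ) ≤ k := by exact_mod_cast hk1
  have hj' : (0 : ℝ) ≤ j := by exact_mod_cast hj
  have e : 2 * p + (M : ℝ) = 2 * p + 2 * k + j := by rw [hM]; ring
  rw [e, clDiag_twist]
  have h1 : (0 : ℝ) < k := by linarith
  have h2 : (0 : ℝ) < 2 * j + 2 * k + 1 := by linarith
  have h3 : (0 : ℝ) < k + 2 * p - 2 := by linarith
  have h4 : (0 : ℝ) < 2 * j + 2 * k + 4 * p - 3 := by linarith
  have : 0 < k * (2 * j + 2 * k + 1) * (k + 2 * p - 2) * (2 * j + 2 * k + 4 * p - 3) := by positivity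
  linarith

/-! ### The two stencils as operators on `ℤ × ℤ`-indexed arrays -/

/-- The quadratic Casimir in the Hogervorst–Rychkov frame with base `E₀` (entry `(M, j)` = coefficient of
`𝒫_{E₀+M, j}`), in "pull" form: `(𝒟₂x)_{M,j} = C_{E,j} x_{M,j} - ½γ⁺_{E-1,j-1} x_{M-1,j-1} - ½γ⁻_{E-1,j+1} x_{M-1,j+1}`,
`E = E₀ + M`. [cite: HogervorstRychkov2013, §3 eqs. (3.7)–(3.9)] -/
noncomputable def opD2 (E₀ : ℝ) (x : ℤ → ℤ → ℝ) : ℤ → ℤ → ℝ := fun M j =>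
  d2diag (E₀ + (M : ℝ)) (j : ℝ) * x M j +
    d2up (E₀ + ((M - 1 : ℤ) : ℝ)) ((j - 1 : ℤ) : ℝ) * x (M - 1) (j - 1) +
    d2dn (E₀ + ((M - 1 : ℤ) : ℝ)) ((j + 1 : ℤ) : ℝ) * x (M - 1) (j + 1)

/-- The closure operator `𝕃_p = 𝒟₄ - (𝒟₂ - c₀)(𝒟₂ - c₁)` in the Hogervorst–Rychkov frame with base `E₀`,
pull form (four-point stencil: `(0,0)`, `(1,±1)`, `(2,0)`). [cite: DolanOsborn2011, §4.2] -/
noncomputable def opL (p E₀ : ℝ) (x : ℤ → ℤ → ℝ) : ℤ → ℤ → ℝ := fun M j =>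
  clDiag p (E₀ + (M : ℝ)) (j : ℝ) * x M j +
    clUp p (E₀ + ((M - 1 : ℤ) : ℝ)) ((j - 1 : ℤ) : ℝ) * x (M - 1) (j - 1) +
    clDn p (E₀ + ((M - 1 : ℤ) : ℝ)) ((j + 1 : ℤ) : ℝ) * x (M - 1) (j + 1) +
    clTwo (E₀ + ((M - 2 : ℤ) : ℝ)) (j : ℝ) * x (M - 2) j

/-- `opD2` is linear: subtraction. [folklore] -/
theorem opD2_sub (E₀ : ℝ) (x y : ℤ → ℤ → ℝ) :
    opD2 E₀ (fun M j => x M j - y M j) = fun M j => opD2 E₀ x M j - opD2 E₀ y M j := by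
  funext M j; simp only [opD2]; ring

/-- `opL` is linear: subtraction. [folklore] -/
theorem opL_sub (p E₀ : ℝ) (x y : ℤ → ℤ → ℝ) :
    opL p E₀ (fun M j => x M j - y M j) = fun M j => opL p E₀ x M j - opL p E₀ y M j := by
  funext M j; simp only [opL]; ring

/-- `opL` is linear: scalars. [folklore] -/
theorem opL_smul (p E₀ c : ℝ) (x : ℤ → ℤ → ℝ) :
    opL p E₀ (fun M j => c * x M j) = fun M j => c * opL p E₀ x M j := by
  funext M j; simp only [opL]; ring

/-- `opD2` is linear: scalars. [folklore] -/
theorem opD2_smul (E₀ c : ℝ) (x : ℤ → ℤ → ℝ) :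
    opD2 E₀ (fun M j => c * x M j) = fun M j => c * opD2 E₀ x M j := by
  funext M j; simp only [opD2]; ring

/-- Shifting the base: `opD2 E₀` on an array shifted up by `M₀` levels is `opD2 (E₀+M₀)` shifted. [folklore] -/
theorem opD2_shift (E₀ : ℝ) (M₀ : ℤ) (x : ℤ → ℤ → ℝ) :
    opD2 E₀ (fun M j => x (M - M₀) j) = fun M j => opD2 (E₀ + M₀) x (M - M₀) j := by
  funext M j
  simp only [opD2]
  have e1 : M - 1 - M₀ = M - M₀ - 1 := by ring
  have e2 : (E₀ + ((M - 1 : ℤ) : ℝ)) = E₀ + (M₀ : ℝ) + ((M - M₀ - 1 : ℤ) : ℝ) := by push_cast; ring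
  have e3 : (E₀ + (M : ℝ)) = E₀ + (M₀ : ℝ) + ((M - M₀ : ℤ) : ℝ) := by push_cast; ring
  rw [e1, e2, e3]

/-- Shifting the base for `opL`. [folklore] -/
theorem opL_shift (p E₀ : ℝ) (M₀ : ℤ) (x : ℤ → ℤ → ℝ) :
    opL p E₀ (fun M j => x (M - M₀) j) = fun M j => opL p (E₀ + M₀) x (M - M₀) j := by
  funext M j
  simp only [opL]
  have e1 : M - 1 - M₀ = M - M₀ - 1 := by ring
  have e1' : M - 2 - M₀ = M - M₀ - 2 := by ring
  have e2 : (E₀ + ((M - 1 : ℤ) : ℝ)) = E₀ + (M₀ : ℝ) + ((M - M₀ - 1 : ℤ) : ℝ) := by push_cast; ring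
  have e2' : (E₀ + ((M - 2 : ℤ) : ℝ)) = E₀ + (M₀ : ℝ) + ((M - M₀ - 2 : ℤ) : ℝ) := by push_cast; ring
  have e3 : (E₀ + (M : ℝ)) = E₀ + (M₀ : ℝ) + ((M - M₀ : ℤ) : ℝ) := by push_cast; ring
  rw [e1, e1', e2, e2', e3]

/-! ### Commutation of the two stencils -/

/-- Odd integers are non-zero reals: `2j + 1 ≠ 0`. [folklore] -/
theorem two_mul_intCast_add_one_ne_zero (j : ℤ) : 2 * (j : ℝ) + 1 ≠ 0 := by
  have : (2 * j + 1 : ℤ) ≠ 0 := by omega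
  exact_mod_cast this

section comm
variable (p E₀ : ℝ) (M j : ℤ)

/-- Commutator coefficient at `x_{M-1,j-1}` vanishes. [cite: DolanOsborn2011, §4.2] -/
theorem comm_coef₁ :
    d2diag (E₀ + (M : ℝ)) (j : ℝ) * clUp p (E₀ + ((M - 1 : ℤ) : ℝ)) ((j - 1 : ℤ) : ℝ) +
        d2up (E₀ + ((M - 1 : ℤ) : ℝ)) ((j - 1 : ℤ) : ℝ) * clDiag p (E₀ + ((M - 1 : ℤ) : ℝ)) ((j - 1 : ℤ) : ℝ) =
      clDiag p (E₀ + (M : ℝ)) (j : ℝ) * d2up (E₀ + ((M - 1 : ℤ) : ℝ)) ((j - 1 : ℤ) : ℝ) +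
        clUp p (E₀ + ((M - 1 : ℤ) : ℝ)) ((j - 1 : ℤ) : ℝ) * d2diag (E₀ + ((M - 1 : ℤ) : ℝ)) ((j - 1 : ℤ) : ℝ) := by
  have h := two_mul_intCast_add_one_ne_zero (j - 1)
  push_cast at h ⊢
  simp only [d2diag, d2up, clDiag, clUp]
  field_simp
  ring

/-- Commutator coefficient at `x_{M-1,j+1}` vanishes. [cite: DolanOsborn2011, §4.2] -/
theorem comm_coef₂ :
    d2diag (E₀ + (M : ℝ)) (j : ℝ) * clDn p (E₀ + ((M - 1 : ℤ) : ℝ)) ((j + 1 : ℤ) : ℝ) +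
        d2dn (E₀ + ((M - 1 : ℤ) : ℝ)) ((j + 1 : ℤ) : ℝ) * clDiag p (E₀ + ((M - 1 : ℤ) : ℝ)) ((j + 1 : ℤ) : ℝ) =
      clDiag p (E₀ + (M : ℝ)) (j : ℝ) * d2dn (E₀ + ((M - 1 : ℤ) : ℝ)) ((j + 1 : ℤ) : ℝ) +
        clDn p (E₀ + ((M - 1 : ℤ) : ℝ)) ((j + 1 : ℤ) : ℝ) * d2diag (E₀ + ((M - 1 : ℤ) : ℝ)) ((j + 1 : ℤ) : ℝ) := by
  have h := two_mul_intCast_add_one_ne_zero (j + 1)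
  push_cast at h ⊢
  simp only [d2diag, d2dn, clDiag, clDn]
  field_simp
  ring

set_option maxHeartbeats 800000 in
/-- Commutator coefficient at `x_{M-2,j}` vanishes. [cite: DolanOsborn2011, §4.2] -/
theorem comm_coef₃ :
    d2diag (E₀ + (M : ℝ)) (j : ℝ) * clTwo (E₀ + ((M - 2 : ℤ) : ℝ)) (j : ℝ) +
        d2up (E₀ + ((M - 1 : ℤ) : ℝ)) ((j - 1 : ℤ) : ℝ) * clDn p (E₀ + ((M - 2 : ℤ) : ℝ)) (j : ℝ) +
        d2dn (E₀ + ((M - 1 : ℤ) : ℝ)) ((j + 1 : ℤ) : ℝ) * clUp p (E₀ + ((M - 2 : ℤ) : ℝ)) (j : ℝ) =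
      clUp p (E₀ + ((M - 1 : ℤ) : ℝ)) ((j - 1 : ℤ) : ℝ) * d2dn (E₀ + ((M - 2 : ℤ) : ℝ)) (j : ℝ) +
        clDn p (E₀ + ((M - 1 : ℤ) : ℝ)) ((j + 1 : ℤ) : ℝ) * d2up (E₀ + ((M - 2 : ℤ) : ℝ)) (j : ℝ) +
        clTwo (E₀ + ((M - 2 : ℤ) : ℝ)) (j : ℝ) * d2diag (E₀ + ((M - 2 : ℤ) : ℝ)) (j : ℝ) := by
  have h1 := two_mul_intCast_add_one_ne_zero j
  have h2 := two_mul_intCast_add_one_ne_zero (j - 1)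
  have h3 := two_mul_intCast_add_one_ne_zero (j + 1)
  push_cast at h1 h2 h3 ⊢
  have h2' : (2 * (j : ℝ) - 1) ≠ 0 := fun h => h2 (by linarith)
  have h3' : (2 * (j : ℝ) + 3) ≠ 0 := fun h => h3 (by linarith)
  simp only [d2diag, d2up, d2dn, clUp, clDn, clTwo, div_mul_div_comm]
  have hA : (2 : ℝ) * (2 * (2 * ((j : ℝ) - 1) + 1)) ≠ 0 := mul_ne_zero two_ne_zero (mul_ne_zero two_ne_zero h2)
  have hB : (2 * (2 * ((j : ℝ) - 1) + 1)) * (2 * (2 * (j : ℝ) + 1)) ≠ 0 :=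
    mul_ne_zero (mul_ne_zero two_ne_zero h2) (mul_ne_zero two_ne_zero h1)
  have hC : (2 * (2 * ((j : ℝ) + 1) + 1)) * (2 * (2 * (j : ℝ) + 1)) ≠ 0 :=
    mul_ne_zero (mul_ne_zero two_ne_zero h3) (mul_ne_zero two_ne_zero h1)
  have hD : (2 : ℝ) * 4 ≠ 0 := by norm_num
  have hD' : (4 : ℝ) * 2 ≠ 0 := by norm_num
  rw [div_add_div _ _ hD hB, div_add_div _ _ (mul_ne_zero hD hB) hC,
    div_add_div _ _ hB hC, div_add_div _ _ (mul_ne_zero hB hC) hD',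
    div_eq_div_iff (mul_ne_zero (mul_ne_zero hD hB) hC) (mul_ne_zero (mul_ne_zero hB hC) hD')]
  ring

/-- Commutator coefficient at `x_{M-2,j-2}` vanishes. [cite: DolanOsborn2011, §4.2] -/
theorem comm_coef₄ :
    d2up (E₀ + ((M - 1 : ℤ) : ℝ)) ((j - 1 : ℤ) : ℝ) * clUp p (E₀ + ((M - 2 : ℤ) : ℝ)) ((j - 2 : ℤ) : ℝ) =
      clUp p (E₀ + ((M - 1 : ℤ) : ℝ)) ((j - 1 : ℤ) : ℝ) * d2up (E₀ + ((M - 2 : ℤ) : ℝ)) ((j - 2 : ℤ) : ℝ) := by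
  have h2 := two_mul_intCast_add_one_ne_zero (j - 1)
  have h4 := two_mul_intCast_add_one_ne_zero (j - 2)
  push_cast at h2 h4 ⊢
  simp only [d2up, clUp]
  field_simp
  ring

/-- Commutator coefficient at `x_{M-2,j+2}` vanishes. [cite: DolanOsborn2011, §4.2] -/
theorem comm_coef₅ :
    d2dn (E₀ + ((M - 1 : ℤ) : ℝ)) ((j + 1 : ℤ) : ℝ) * clDn p (E₀ + ((M - 2 : ℤ) : ℝ)) ((j + 2 : ℤ) : ℝ) =
      clDn p (E₀ + ((M - 1 : ℤ) : ℝ)) ((j + 1 : ℤ) : ℝ) * d2dn (E₀ + ((M - 2 : ℤ) : ℝ)) ((j + 2 : ℤ) : ℝ) := by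
  have h3 := two_mul_intCast_add_one_ne_zero (j + 1)
  have h5 := two_mul_intCast_add_one_ne_zero (j + 2)
  push_cast at h3 h5 ⊢
  simp only [d2dn, clDn]
  field_simp
  ring

/-- Commutator coefficient at `x_{M-3,j-1}` vanishes. [cite: DolanOsborn2011, §4.2] -/
theorem comm_coef₆ :
    d2up (E₀ + ((M - 1 : ℤ) : ℝ)) ((j - 1 : ℤ) : ℝ) * clTwo (E₀ + ((M - 3 : ℤ) : ℝ)) ((j - 1 : ℤ) : ℝ) =
      clTwo (E₀ + ((M - 2 : ℤ) : ℝ)) (j : ℝ) * d2up (E₀ + ((M - 3 : ℤ) : ℝ)) ((j - 1 : ℤ) : ℝ) := by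
  have h2 := two_mul_intCast_add_one_ne_zero (j - 1)
  push_cast at h2 ⊢
  simp only [d2up, clTwo]
  field_simp
  ring

/-- Commutator coefficient at `x_{M-3,j+1}` vanishes. [cite: DolanOsborn2011, §4.2] -/
theorem comm_coef₇ :
    d2dn (E₀ + ((M - 1 : ℤ) : ℝ)) ((j + 1 : ℤ) : ℝ) * clTwo (E₀ + ((M - 3 : ℤ) : ℝ)) ((j + 1 : ℤ) : ℝ) =
      clTwo (E₀ + ((M - 2 : ℤ) : ℝ)) (j : ℝ) * d2dn (E₀ + ((M - 3 : ℤ) : ℝ)) ((j + 1 : ℤ) : ℝ) := by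
  have h3 := two_mul_intCast_add_one_ne_zero (j + 1)
  push_cast at h3 ⊢
  simp only [d2dn, clTwo]
  field_simp
  ring

end comm

/-- **The closure stencil commutes with the quadratic Casimir stencil**: `𝒟₂ 𝕃_p = 𝕃_p 𝒟₂` as operators on
arrays (Dolan–Osborn 2011 §4.2: `[Δ₂, Δ₄] = 0`; here the seven rational identities `comm_coef₁`–`comm_coef₇`
between the stencil coefficients). [cite: DolanOsborn2011, §4.2] -/
theorem opD2_opL_comm (p E₀ : ℝ) (x : ℤ → ℤ → ℝ) :
    opD2 E₀ (opL p E₀ x) = opL p E₀ (opD2 E₀ x) := by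
  funext M j
  simp only [opD2, opL]
  have i1 : M - 1 - 1 = M - 2 := by ring
  have i2 : j - 1 - 1 = j - 2 := by ring
  have i5 : j + 1 + 1 = j + 2 := by ring
  have i6 : M - 1 - 2 = M - 3 := by ring
  have i7 : M - 2 - 1 = M - 3 := by ring
  simp only [i1, i2, i5, i6, i7, sub_add_cancel, add_sub_cancel_right]
  linear_combination (x (M - 1) (j - 1)) * comm_coef₁ p E₀ M j + (x (M - 1) (j + 1)) * comm_coef₂ p E₀ M j +
    (x (M - 2) j) * comm_coef₃ p E₀ M j + (x (M - 2) (j - 2)) * comm_coef₄ p E₀ M j +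
    (x (M - 2) (j + 2)) * comm_coef₅ p E₀ M j + (x (M - 3) (j - 1)) * comm_coef₆ E₀ M j +
    (x (M - 3) (j + 1)) * comm_coef₇ E₀ M j

/-! ### The block array on `ℤ × ℤ` and its eigen-properties -/

/-- The Hogervorst–Rychkov coefficient array `A_{n,j}(Δ,ℓ)` extended by zero to `ℤ × ℤ`. [cite: HogervorstRychkov2013, §3 eq. (3.9)] -/
noncomputable def hrCoeffZ (Δ : ℝ) (ℓ : ℕ) (n j : ℤ) : ℝ :=
  if 0 ≤ n ∧ 0 ≤ j then hrCoeff Δ ℓ n.toNat j.toNat else 0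

/-- On natural indices `hrCoeffZ` is `hrCoeff`. [folklore] -/
theorem hrCoeffZ_natCast (Δ : ℝ) (ℓ n j : ℕ) : hrCoeffZ Δ ℓ (n : ℤ) (j : ℤ) = hrCoeff Δ ℓ n j := by
  simp [hrCoeffZ]

/-- `hrCoeffZ` vanishes at negative level. [folklore] -/
theorem hrCoeffZ_of_neg_left (Δ : ℝ) (ℓ : ℕ) {n : ℤ} (hn : n < 0) (j : ℤ) : hrCoeffZ Δ ℓ n j = 0 := by
  simp [hrCoeffZ, not_le.mpr hn]

/-- `hrCoeffZ` vanishes at negative spin. [folklore] -/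
theorem hrCoeffZ_of_neg_right (Δ : ℝ) (ℓ : ℕ) (n : ℤ) {j : ℤ} (hj : j < 0) : hrCoeffZ Δ ℓ n j = 0 := by
  simp [hrCoeffZ, not_le.mpr hj]

/-- The descendant range on `ℤ × ℤ`: `0 ≤ j`, `ℓ ≤ j + n`, `j ≤ ℓ + n`, `j + ℓ + n` even (then `0 ≤ n`).
[cite: HogervorstRychkov2013, §3 eq. (3.5)] -/
def InRangeZ (ℓ : ℕ) (n j : ℤ) : Prop :=
  0 ≤ j ∧ (ℓ : ℤ) ≤ j + n ∧ j ≤ ℓ + n ∧ Even (j + ℓ + n)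

/-- On natural indices `InRangeZ` is `InDescendantRange`. [folklore] -/
theorem inRangeZ_natCast (ℓ n j : ℕ) : InRangeZ ℓ (n : ℤ) (j : ℤ) ↔ InDescendantRange ℓ n j := by
  unfold InRangeZ InDescendantRange
  constructor
  · rintro ⟨-, h1, h2, h3⟩
    refine ⟨by exact_mod_cast h1, by exact_mod_cast h2, ?_⟩
    obtain ⟨k, hk⟩ := h3
    omega
  · rintro ⟨h1, h2, h3⟩
    refine ⟨by positivity, by exact_mod_cast h1, by exact_mod_cast h2, ?_⟩
    exact ⟨((j + ℓ + n) / 2 : ℕ), by omega⟩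

/-- `hrCoeffZ` is supported on the descendant range. [cite: HogervorstRychkov2013, §3 eq. (3.5)] -/
theorem hrCoeffZ_eq_zero_of_not_inRangeZ (Δ : ℝ) (ℓ : ℕ) {n j : ℤ} (h : ¬ InRangeZ ℓ n j) :
    hrCoeffZ Δ ℓ n j = 0 := by
  unfold hrCoeffZ
  split_ifs with hnj
  · obtain ⟨hn, hj⟩ := hnj
    obtain ⟨n', rfl⟩ := Int.eq_ofNat_of_zero_le hn
    obtain ⟨j', rfl⟩ := Int.eq_ofNat_of_zero_le hj
    simp only [Int.toNat_natCast]
    apply hrCoeff_eq_zero_of_not_inDescendantRange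
    rwa [← inRangeZ_natCast]
  · rfl

/-- Unfolding `opD2` at a natural point `(m+1, j)` with natural casts. [folklore] -/
theorem opD2_apply_succ (E₀ : ℝ) (x : ℤ → ℤ → ℝ) (m j : ℕ) :
    opD2 E₀ x ((m : ℤ) + 1) (j : ℤ) =
      d2diag (E₀ + ((m : ℝ) + 1)) (j : ℝ) * x ((m : ℤ) + 1) j +
        d2up (E₀ + (m : ℝ)) ((j : ℝ) - 1) * x m ((j : ℤ) - 1) +
        d2dn (E₀ + (m : ℝ)) ((j : ℝ) + 1) * x m ((j : ℤ) + 1) := by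
  simp only [opD2]
  push_cast
  simp only [add_sub_cancel_right]

/-- Unfolding `opD2` at level `0` for an array vanishing at level `-1`. [folklore] -/
theorem opD2_apply_zero (E₀ : ℝ) (x : ℤ → ℤ → ℝ) (hx : ∀ j, x (-1) j = 0) (j : ℤ) :
    opD2 E₀ x 0 j = d2diag E₀ j * x 0 j := by
  simp only [opD2]
  have e : (0 : ℤ) - 1 = -1 := by norm_num
  rw [e, hx, hx]
  push_cast
  ring

/-- Unfolding `opL` at level `0` for an array vanishing at levels `-1`, `-2`. [folklore] -/
theorem opL_apply_zero (p E₀ : ℝ) (x : ℤ → ℤ → ℝ) (hx : ∀ j, x (-1) j = 0) (hx2 : ∀ j, x (-2) j = 0) (j : ℤ) :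
    opL p E₀ x 0 j = clDiag p E₀ j * x 0 j := by
  simp only [opL]
  have e : (0 : ℤ) - 1 = -1 := by norm_num
  have e2 : (0 : ℤ) - 2 = -2 := by norm_num
  rw [e, e2, hx, hx, hx2]
  push_cast
  ring

/-- **The block array is an eigen-array of the quadratic stencil**: for `Δ` strictly above the unitarity bound,
`𝒟₂ A(Δ,ℓ) = C_{Δ,ℓ} A(Δ,ℓ)` entrywise on `ℤ × ℤ` (the recursion (3.9) where the pivot is positive; both sides
zero off the descendant range and at negative indices). [cite: HogervorstRychkov2013, §3 eq. (3.9)] -/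
theorem opD2_hrCoeffZ {Δ : ℝ} {ℓ : ℕ} (hΔ : unitarityBound3D ℓ < Δ) :
    opD2 Δ (hrCoeffZ Δ ℓ) = fun n j => casimirEigenvalue3D Δ ℓ * hrCoeffZ Δ ℓ n j := by
  funext n j
  -- negative spin: everything vanishes (`d2dn _ 0 = 0` handles `j = -1`)
  by_cases hj : 0 ≤ j
  swap
  · have hj' : j < 0 := not_le.mp hj
    simp only [opD2]
    rw [hrCoeffZ_of_neg_right _ _ _ hj', hrCoeffZ_of_neg_right _ _ _ (by omega : j - 1 < 0)]
    rcases lt_or_eq_of_le (show j + 1 ≤ 0 by omega) with h | h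
    · rw [hrCoeffZ_of_neg_right _ _ _ h]; ring
    · rw [h]; push_cast; simp
  -- negative level
  by_cases hn : 0 ≤ n
  swap
  · have hn' : n < 0 := not_le.mp hn
    simp only [opD2]
    rw [hrCoeffZ_of_neg_left _ _ hn', hrCoeffZ_of_neg_left _ _ (by omega : n - 1 < 0),
      hrCoeffZ_of_neg_left _ _ (by omega : n - 1 < 0)]
    ring
  obtain ⟨n', rfl⟩ := Int.eq_ofNat_of_zero_le hn
  obtain ⟨j', rfl⟩ := Int.eq_ofNat_of_zero_le hj
  rw [hrCoeffZ_natCast]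
  cases n' with
  | zero =>
    rw [show ((0 : ℕ) : ℤ) = 0 from rfl,
      opD2_apply_zero Δ _ (fun k => hrCoeffZ_of_neg_left Δ ℓ (by norm_num) k)]
    rw [show hrCoeffZ Δ ℓ 0 (j' : ℤ) = hrCoeff Δ ℓ 0 j' from hrCoeffZ_natCast Δ ℓ 0 j']
    by_cases hjl : j' = ℓ
    · subst hjl; simp [d2diag_eq]
    · rw [hrCoeff_zero_of_ne Δ hjl]; ring
  | succ m =>
    push_cast
    rw [opD2_apply_succ]
    rw [show ((m : ℤ) + 1) = ((m + 1 : ℕ) : ℤ) by push_cast; ring, hrCoeffZ_natCast,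
      show ((j' : ℤ) + 1) = ((j' + 1 : ℕ) : ℤ) by push_cast; ring, hrCoeffZ_natCast,
      d2diag_eq, show ((j' : ℝ) + 1) = ((j' + 1 : ℕ) : ℝ) by push_cast; ring, d2dn_eq]
    -- the `j' - 1` parent
    have hup : d2up (Δ + (m : ℝ)) ((j' : ℝ) - 1) * hrCoeffZ Δ ℓ (m : ℤ) ((j' : ℤ) - 1) =
        -(1/2) * (if j' = 0 then 0 else hrGammaPlus (Δ + m) (j' - 1) * hrCoeff Δ ℓ m (j' - 1)) := by
      by_cases hj0 : j' = 0
      · subst hj0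
        rw [if_pos rfl, hrCoeffZ_of_neg_right _ _ _ (by norm_num)]
        ring
      · rw [if_neg hj0]
        obtain ⟨i, rfl⟩ : ∃ i, j' = i + 1 := ⟨j' - 1, by omega⟩
        rw [show ((i + 1 : ℕ) : ℤ) - 1 = (i : ℤ) by push_cast; ring, hrCoeffZ_natCast,
          show (((i + 1 : ℕ)) : ℝ) - 1 = ((i : ℕ) : ℝ) by push_cast; ring, d2up_eq,
          Nat.add_sub_cancel]
        ring
    rw [hup]
    by_cases hpiv : casimirPivot3D Δ ℓ (m + 1) j' = 0
    · -- off the descendant range: everything vanishes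
      have hout : ¬ InDescendantRange ℓ (m + 1) j' := by
        intro hr
        exact (casimirPivot3D_pos hΔ (by omega) hr.1 hr.2.1 hr.2.2).ne' hpiv
      have hp1 : ¬ InDescendantRange ℓ m (j' + 1) := by
        rintro ⟨a, b, c⟩; exact hout ⟨by omega, by omega, by omega⟩
      rw [hrCoeff_eq_zero_of_not_inDescendantRange Δ hout,
        hrCoeff_eq_zero_of_not_inDescendantRange Δ hp1]
      by_cases hj0 : j' = 0
      · simp [hj0]
      · have hp2 : ¬ InDescendantRange ℓ m (j' - 1) := by
          rintro ⟨a, b, c⟩; exact hout ⟨by omega, by omega, by omega⟩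
        rw [if_neg hj0, hrCoeff_eq_zero_of_not_inDescendantRange Δ hp2]
        ring
    · have hrec := hrCoeff_succ_rec (Δ := Δ) (ℓ := ℓ) (n := m) (j := j') hpiv
      have hpe := casimirPivot3D_eq Δ ℓ (m + 1) j'
      push_cast at hpe
      have key : (casimirEigenvalue3D (Δ + ((m : ℝ) + 1)) j' - casimirEigenvalue3D Δ ℓ) *
          hrCoeff Δ ℓ (m + 1) j' =
          (1/2) * ((if j' = 0 then 0 else hrGammaPlus (Δ + m) (j' - 1) * hrCoeff Δ ℓ m (j' - 1)) +
            hrGammaMinus (Δ + m) (j' + 1) * hrCoeff Δ ℓ m (j' + 1)) := by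
        rw [← hrec, hpe]; ring
      linarith [key]

/-- **Uniqueness of range-supported eigen-arrays with given apex.** If `y : ℤ → ℤ → ℝ` vanishes off the
descendant range of `(Δ, ℓ)`, satisfies `𝒟₂ y = C_{Δ,ℓ} y`, and has apex `y_{0,j} = c δ_{jℓ}`, then `y = c · A(Δ,ℓ)`
(`Δ` above the unitarity bound: the pivots on the range are positive). [cite: HogervorstRychkov2013, §3 eq. (3.9)] -/
theorem eq_smul_hrCoeffZ_of_eigen {Δ : ℝ} {ℓ : ℕ} (hΔ : unitarityBound3D ℓ < Δ) {y : ℤ → ℤ → ℝ} {c : ℝ}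
    (hsupp : ∀ n j, ¬ InRangeZ ℓ n j → y n j = 0)
    (heig : opD2 Δ y = fun n j => casimirEigenvalue3D Δ ℓ * y n j)
    (hapex : ∀ j : ℤ, y 0 j = if j = ℓ then c else 0) :
    y = fun n j => c * hrCoeffZ Δ ℓ n j := by
  have hnat : ∀ n : ℕ, ∀ j : ℕ, y n j = c * hrCoeff Δ ℓ n j := by
    intro n
    induction n with
    | zero =>
      intro j
      rw [show ((0 : ℕ) : ℤ) = 0 from rfl, hapex]
      by_cases h : j = ℓ
      · subst h; simp
      · rw [if_neg (by exact_mod_cast h), hrCoeff_zero_of_ne Δ h]; ring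
    | succ m ih =>
      intro j
      by_cases hr : InDescendantRange ℓ (m + 1) j
      · have hpiv := casimirPivot3D_pos hΔ (by omega) hr.1 hr.2.1 hr.2.2
        have hpe := casimirPivot3D_eq Δ ℓ (m + 1) j
        have he := congrFun (congrFun heig ((m + 1 : ℕ) : ℤ)) (j : ℤ)
        push_cast at he
        rw [opD2_apply_succ] at he
        -- parents at level `m`
        have hp_up : d2up (Δ + (m : ℝ)) ((j : ℝ) - 1) * y m ((j : ℤ) - 1) =
            c * (-(1/2) * (if j = 0 then 0 else hrGammaPlus (Δ + m) (j - 1) * hrCoeff Δ ℓ m (j - 1))) := by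
          by_cases hj0 : j = 0
          · subst hj0
            have hz : y (m : ℤ) (-1) = 0 :=
              hsupp _ _ (fun h => by obtain ⟨h, _⟩ := h; norm_num at h)
            rw [if_pos rfl]
            push_cast
            simp [hz]
          · rw [if_neg hj0]
            obtain ⟨i, rfl⟩ : ∃ i, j = i + 1 := ⟨j - 1, by omega⟩
            rw [show ((i + 1 : ℕ) : ℤ) - 1 = (i : ℤ) by push_cast; ring, ih,
              show (((i + 1 : ℕ)) : ℝ) - 1 = ((i : ℕ) : ℝ) by push_cast; ring, d2up_eq, Nat.add_sub_cancel]
            ring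
        have hp_dn : d2dn (Δ + (m : ℝ)) ((j : ℝ) + 1) * y m ((j : ℤ) + 1) =
            c * (-(1/2) * (hrGammaMinus (Δ + m) (j + 1) * hrCoeff Δ ℓ m (j + 1))) := by
          rw [show ((j : ℤ) + 1) = ((j + 1 : ℕ) : ℤ) by push_cast; ring, ih,
            show ((j : ℝ) + 1) = ((j + 1 : ℕ) : ℝ) by push_cast; ring, d2dn_eq]
          ring
        rw [hp_up, hp_dn, d2diag_eq, show ((m : ℤ) + 1) = ((m + 1 : ℕ) : ℤ) by push_cast; ring] at he
        have hrec := hrCoeff_succ_rec (Δ := Δ) (ℓ := ℓ) (n := m) (j := j) hpiv.ne'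
        push_cast at hpe
        have h1 : (casimirEigenvalue3D (Δ + ((m : ℝ) + 1)) j - casimirEigenvalue3D Δ ℓ) * y ↑(m + 1) ↑j =
            c * ((1/2) * (casimirPivot3D Δ ℓ (m + 1) j * hrCoeff Δ ℓ (m + 1) j)) := by
          rw [hrec]; linarith [he]
        rw [hpe] at h1
        have hne : casimirEigenvalue3D (Δ + ((m : ℝ) + 1)) j - casimirEigenvalue3D Δ ℓ ≠ 0 := by
          intro h0; rw [hpe, h0] at hpiv; linarith
        have h2 : (casimirEigenvalue3D (Δ + ((m : ℝ) + 1)) j - casimirEigenvalue3D Δ ℓ) *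
            (y ↑(m + 1) ↑j - c * hrCoeff Δ ℓ (m + 1) j) = 0 := by linarith [h1]
        rcases mul_eq_zero.mp h2 with h | h
        · exact absurd h hne
        · linarith
      · rw [hsupp _ _ (by rwa [inRangeZ_natCast]), hrCoeff_eq_zero_of_not_inDescendantRange Δ hr]
        ring
  funext n j
  by_cases hnj : InRangeZ ℓ n j
  · obtain ⟨hj, h1, _, _⟩ := hnj
    have hn : 0 ≤ n := by omega
    obtain ⟨n', rfl⟩ := Int.eq_ofNat_of_zero_le hn
    obtain ⟨j', rfl⟩ := Int.eq_ofNat_of_zero_le hj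
    rw [hnat, hrCoeffZ_natCast]
  · rw [hsupp _ _ hnj, hrCoeffZ_eq_zero_of_not_inRangeZ _ _ hnj]; ring

/-- The closure stencil maps arrays supported on the descendant range of `(Δ,ℓ)` to arrays supported there.
[folklore] -/
theorem opL_eq_zero_of_not_inRangeZ (p E₀ : ℝ) (ℓ : ℕ) {x : ℤ → ℤ → ℝ}
    (hx : ∀ n j, ¬ InRangeZ ℓ n j → x n j = 0) {n j : ℤ} (h : ¬ InRangeZ ℓ n j) :
    opL p E₀ x n j = 0 := by
  simp only [opL]
  by_cases hj : 0 ≤ j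
  · have o1 : ¬ InRangeZ ℓ (n - 1) (j - 1) := by
      rintro ⟨a, b, c, d⟩; apply h; refine ⟨hj, by omega, by omega, ?_⟩
      obtain ⟨k, hk⟩ := d; exact ⟨k + 1, by omega⟩
    have o2 : ¬ InRangeZ ℓ (n - 1) (j + 1) := by
      rintro ⟨a, b, c, d⟩; apply h; refine ⟨hj, by omega, by omega, ?_⟩
      obtain ⟨k, hk⟩ := d; exact ⟨k, by omega⟩
    have o3 : ¬ InRangeZ ℓ (n - 2) j := by
      rintro ⟨a, b, c, d⟩; apply h; refine ⟨hj, by omega, by omega, ?_⟩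
      obtain ⟨k, hk⟩ := d; exact ⟨k + 1, by omega⟩
    rw [hx _ _ h, hx _ _ o1, hx _ _ o2, hx _ _ o3]
    ring
  · have hj' : j < 0 := not_le.mp hj
    have z1 : x n j = 0 := hx _ _ (fun hh => by obtain ⟨a, _⟩ := hh; omega)
    have z2 : x (n - 1) (j - 1) = 0 := hx _ _ (fun hh => by obtain ⟨a, _⟩ := hh; omega)
    have z4 : x (n - 2) j = 0 := hx _ _ (fun hh => by obtain ⟨a, _⟩ := hh; omega)
    rw [z1, z2, z4]
    rcases lt_or_eq_of_le (show j + 1 ≤ 0 by omega) with hlt | heq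
    · rw [hx _ _ (fun hh => by obtain ⟨a, _⟩ := hh; omega)]; ring
    · rw [heq]; push_cast; simp

/-- **The block array is an eigen-array of the closure stencil**: for `Δ` strictly above the unitarity bound,
`𝕃_p A(Δ,ℓ) = ℓ_p(Δ,ℓ) A(Δ,ℓ)` with `ℓ_p(Δ,ℓ) = clDiag p Δ ℓ`. Proof: `𝕃_p A` is again a range-supported
eigen-array of `𝒟₂` (commutation) with apex `ℓ_p(Δ,ℓ) δ_{jℓ}`, so uniqueness applies. (Dolan–Osborn 2011 §4.2:
the blocks are eigenfunctions of `Δ₄`.) [cite: DolanOsborn2011, §4.2] -/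
theorem opL_hrCoeffZ {Δ : ℝ} {ℓ : ℕ} (hΔ : unitarityBound3D ℓ < Δ) (p : ℝ) :
    opL p Δ (hrCoeffZ Δ ℓ) = fun n j => clDiag p Δ ℓ * hrCoeffZ Δ ℓ n j := by
  have hsuppA : ∀ n j, ¬ InRangeZ ℓ n j → hrCoeffZ Δ ℓ n j = 0 :=
    fun n j h => hrCoeffZ_eq_zero_of_not_inRangeZ Δ ℓ h
  apply eq_smul_hrCoeffZ_of_eigen hΔ
  · exact fun n j h => opL_eq_zero_of_not_inRangeZ p Δ ℓ hsuppA h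
  · rw [opD2_opL_comm, opD2_hrCoeffZ hΔ, opL_smul]
  · intro j
    rw [opL_apply_zero p Δ _ (fun k => hrCoeffZ_of_neg_left Δ ℓ (by norm_num) k)
      (fun k => hrCoeffZ_of_neg_left Δ ℓ (by norm_num) k)]
    by_cases hj0 : 0 ≤ j
    · obtain ⟨j', rfl⟩ := Int.eq_ofNat_of_zero_le hj0
      rw [show hrCoeffZ Δ ℓ 0 (j' : ℤ) = hrCoeff Δ ℓ 0 j' from hrCoeffZ_natCast Δ ℓ 0 j']
      by_cases hj : j' = ℓ
      · subst hj; simp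
      · rw [if_neg (by exact_mod_cast hj), hrCoeff_zero_of_ne Δ hj]; ring
    · rw [hrCoeffZ_of_neg_right _ _ _ (not_le.mp hj0), if_neg (by omega)]
      ring

end Literature.MathematicalPhysics.QuantumFieldTheory.ConformalBootstrap3D
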